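import Literature.NumberTheory.EllipticCurves.RootNumber
import Literature.NumberTheory.EllipticCurves.BSDRootNumber
import Literature.NumberTheory.EllipticCurves.SzpiroLocalDataProofs
import Literature.NumberTheory.DiophantineGeometry.LocalReductionFiniteBadPlacesProofs
import Mathlib.NumberTheory.ArithmeticFunction.Misc
import Mathlib.NumberTheory.Padics.HeightOneSpectrum
import HarnessLib

/-!
# Stub `stub_assemble` (line `SketchIdeator2`, crux `MobiusLadder.LiouvilleNotPPoly`)

Assembly of the algebraic root number of the `X₁(3)` family
`E_t : y² + x·y + t·y = x³` (`a₁ = 1`, `a₃ = t`, `Δ = t³(1 − 27t) = −t³(27t − 1)`), `t ≥ 1`,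
from the two Tate-algorithm inputs (the neighbouring stubs, taken here as hypotheses):

* C1: split multiplicative reduction at every place `v` with `p_v ∣ t`;
* C2: multiplicative reduction at every place `v` with `p_v ∣ 27t − 1`, split iff `p_v ≡ 1 (mod 3)`.

At every other place `p_v ∤ t(27t − 1) = |Δ|`, so `v(Δ) = 1` and the (integral) equation has good
reduction (`WeierstrassCurve.hasGoodReductionAt_of_valuation_le_one_of_valuation_Δ_eq_one`).
Hence `E_t` is elliptic, has no additive place, and by Rohrlich's local signs
(`w_v = 1` good, `−1` split, `+1` non-split) the algebraic root number
`−∏ᶠ_v w_v(E_t)` is the finite product over the primes of `t(27t − 1)`; since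
`gcd(t, 27t − 1) = 1` it splits as `−(−1)^{ω(t)} · (−1)^{#{p ∣ 27t−1 : p ≡ 1 (mod 3)}}`.
-/

set_option linter.dupNamespace false -- D-0017: single-problem summit ⇒ QuantumAdvantage.QuantumAdvantage by design

noncomputable section

namespace Summit.QuantumAdvantage.QuantumAdvantage.Theorems.LiouvilleNotPPoly

open scoped Classical
open IsDedekindDomain Rat.HeightOneSpectrum

namespace StubAssemble

/-! ### Arithmetic of `t` and `27t − 1` -/

/-- `t` and `27t − 1` are coprime (`t ≥ 1`): a common divisor divides `27t − (27t − 1) = 1`. -/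
theorem coprime_self_mul_sub_one {t : ℕ} (ht : 1 ≤ t) : Nat.Coprime t (27 * t - 1) := by
  have h1 : Nat.gcd t (27 * t - 1) ∣ 27 * t := Dvd.dvd.mul_left (Nat.gcd_dvd_left _ _) 27
  have h2 : Nat.gcd t (27 * t - 1) ∣ 27 * t - (27 * t - 1) := Nat.dvd_sub h1 (Nat.gcd_dvd_right _ _)
  have h3 : 27 * t - (27 * t - 1) = 1 := by omega
  rw [h3, Nat.dvd_one] at h2
  exact h2

/-- A prime factor of `27t − 1` does not divide `t`. -/
theorem not_dvd_of_mem_primeFactors {t : ℕ} (ht : 1 ≤ t) {p : ℕ}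
    (hp : p ∈ (27 * t - 1).primeFactors) : ¬ p ∣ t := fun h =>
  (Nat.prime_of_mem_primeFactors hp).ne_one
    (Nat.eq_one_of_dvd_coprimes (coprime_self_mul_sub_one ht) h (Nat.dvd_of_mem_primeFactors hp))

/-- The finite product of the local signs over the primes of `t(27t − 1)` splits along
`gcd(t, 27t − 1) = 1` into `(−1)^{ω(t)} · (−1)^{#{p ∣ 27t − 1 : p ≡ 1 (mod 3)}}`. -/
theorem prod_primeFactors_sign {t : ℕ} (ht : 1 ≤ t) :
    ∏ p ∈ (t * (27 * t - 1)).primeFactors,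
        (if p ∣ t then (-1 : ℤ) else if p % 3 = 1 then -1 else 1) =
      (-1 : ℤ) ^ ArithmeticFunction.cardDistinctFactors t *
        (-1) ^ ((27 * t - 1).primeFactors.filter fun p => p % 3 = 1).card := by
  rw [(coprime_self_mul_sub_one ht).primeFactors_mul,
    Finset.prod_union (coprime_self_mul_sub_one ht).disjoint_primeFactors]
  have hA : ∏ p ∈ t.primeFactors, (if p ∣ t then (-1 : ℤ) else if p % 3 = 1 then -1 else 1) =
      ∏ _p ∈ t.primeFactors, (-1 : ℤ) :=
    Finset.prod_congr rfl fun p hp => if_pos (Nat.dvd_of_mem_primeFactors hp)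
  have hB : ∏ p ∈ (27 * t - 1).primeFactors,
        (if p ∣ t then (-1 : ℤ) else if p % 3 = 1 then -1 else 1) =
      ∏ p ∈ (27 * t - 1).primeFactors, (if p % 3 = 1 then (-1 : ℤ) else 1) :=
    Finset.prod_congr rfl fun p hp => if_neg (not_dvd_of_mem_primeFactors ht hp)
  -- `ω t = #t.primeFactors`
  rw [hA, hB, Finset.prod_const, ArithmeticFunction.cardDistinctFactors_apply,
    ← Nat.toFinset_factors, List.card_toFinset, Finset.prod_ite, Finset.prod_const,
    Finset.prod_const_one, mul_one]

/-! ### Valuations of natural numbers at a finite place of `ℤ` -/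

/-- `v(n) ≤ 1` for a natural number `n`. -/
theorem valuation_natCast_le_one (v : HeightOneSpectrum ℤ) (n : ℕ) :
    v.valuation ℚ (n : ℚ) ≤ 1 := by
  have h : v.valuation ℚ (algebraMap ℤ ℚ (n : ℤ)) ≤ 1 := HeightOneSpectrum.valuation_le_one v _
  rwa [map_natCast] at h

/-- `v(n) = 1 ↔ p_v ∤ n` for a natural number `n`. -/
theorem valuation_natCast_eq_one_iff (v : HeightOneSpectrum ℤ) (n : ℕ) :
    v.valuation ℚ (n : ℚ) = 1 ↔ ¬ natGenerator v ∣ n := by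
  have h := Literature.NumberTheory.EllipticCurves.Rat.valuation_intCast_eq_one_iff v (n : ℤ)
  rwa [Int.cast_natCast, Int.natCast_dvd_natCast] at h

/-! ### The curve `E_t` -/

/-- `Δ(E_t) = −t³(27t − 1)` (`b₂ = 1`, `b₄ = t`, `b₆ = t²`, `b₈ = 0`). -/
theorem hesse_Δ {t : ℕ} (ht : 1 ≤ t) :
    ({ a₁ := 1, a₂ := 0, a₃ := (t : ℚ), a₄ := 0, a₆ := 0 } : WeierstrassCurve ℚ).Δ =
      -((t ^ 3 * (27 * t - 1) : ℕ) : ℚ) := by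
  have h27 : 1 ≤ 27 * t := by omega
  simp only [WeierstrassCurve.Δ, WeierstrassCurve.b₂, WeierstrassCurve.b₄, WeierstrassCurve.b₆,
    WeierstrassCurve.b₈]
  push_cast [Nat.cast_sub h27]
  ring

/-- `E_t` is an elliptic curve for `t ≥ 1` (`Δ = −t³(27t − 1) ≠ 0`). -/
theorem hesse_isElliptic {t : ℕ} (ht : 1 ≤ t) :
    ({ a₁ := 1, a₂ := 0, a₃ := (t : ℚ), a₄ := 0, a₆ := 0 } : WeierstrassCurve ℚ).IsElliptic := by
  refine ⟨isUnit_iff_ne_zero.mpr ?_⟩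
  rw [hesse_Δ ht, neg_ne_zero, Nat.cast_ne_zero]
  exact mul_ne_zero (pow_ne_zero 3 (by omega)) (by omega)

/-- Good reduction of `E_t` at every place `v` with `p_v ∤ t` and `p_v ∤ 27t − 1`: the equation is
integral and `v(Δ) = 1`. -/
theorem hesse_hasGoodReductionAt {t : ℕ} (ht : 1 ≤ t) {v : HeightOneSpectrum ℤ}
    (h1 : ¬ natGenerator v ∣ t) (h2 : ¬ natGenerator v ∣ 27 * t - 1) :
    ({ a₁ := 1, a₂ := 0, a₃ := (t : ℚ), a₄ := 0, a₆ := 0 } : WeierstrassCurve ℚ).HasGoodReductionAt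
      v := by
  refine WeierstrassCurve.hasGoodReductionAt_of_valuation_le_one_of_valuation_Δ_eq_one v _
    ?_ ?_ ?_ ?_ ?_ ?_
  · show v.valuation ℚ (1 : ℚ) ≤ 1
    rw [map_one]
  · show v.valuation ℚ (0 : ℚ) ≤ 1
    rw [map_zero]
    exact zero_le
  · exact valuation_natCast_le_one v t
  · show v.valuation ℚ (0 : ℚ) ≤ 1
    rw [map_zero]
    exact zero_le
  · show v.valuation ℚ (0 : ℚ) ≤ 1
    rw [map_zero]
    exact zero_le
  · rw [hesse_Δ ht, Valuation.map_neg, valuation_natCast_eq_one_iff]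
    intro h
    rcases (prime_natGenerator v).dvd_mul.mp h with h3 | h3
    · exact h1 ((prime_natGenerator v).dvd_of_dvd_pow h3)
    · exact h2 h3

/-- The local root numbers of `E_t` from C1, C2 and good reduction elsewhere:
`w_v = −1` if `p_v ∣ t`; `w_v = −1` or `+1` according as `p_v ≡ 1 (mod 3)` or not if
`p_v ∣ 27t − 1`; `w_v = 1` otherwise. -/
theorem hesse_localRootNumberAt
    (hC1 : ∀ t : ℕ, 1 ≤ t → ∀ v : HeightOneSpectrum ℤ, Rat.HeightOneSpectrum.natGenerator v ∣ t →
      ({ a₁ := 1, a₂ := 0, a₃ := (t : ℚ), a₄ := 0, a₆ := 0 } :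
        WeierstrassCurve ℚ).HasSplitMultiplicativeReductionAt v)
    (hC2 : ∀ t : ℕ, 1 ≤ t → ∀ v : HeightOneSpectrum ℤ,
      Rat.HeightOneSpectrum.natGenerator v ∣ 27 * t - 1 →
      ({ a₁ := 1, a₂ := 0, a₃ := (t : ℚ), a₄ := 0, a₆ := 0 } :
        WeierstrassCurve ℚ).HasMultiplicativeReductionAt v ∧
      (({ a₁ := 1, a₂ := 0, a₃ := (t : ℚ), a₄ := 0, a₆ := 0 } :
        WeierstrassCurve ℚ).HasSplitMultiplicativeReductionAt v ↔
        Rat.HeightOneSpectrum.natGenerator v % 3 = 1))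
    {t : ℕ} (ht : 1 ≤ t) (v : HeightOneSpectrum ℤ) :
    ({ a₁ := 1, a₂ := 0, a₃ := (t : ℚ), a₄ := 0, a₆ := 0 } : WeierstrassCurve ℚ).localRootNumberAt
        v =
      if natGenerator v ∣ t then -1
      else if natGenerator v ∣ 27 * t - 1 then (if natGenerator v % 3 = 1 then -1 else 1)
      else 1 := by
  by_cases h1 : natGenerator v ∣ t
  · rw [if_pos h1]
    exact Literature.NumberTheory.EllipticCurves.localRootNumberAt_of_hasSplitMultiplicativeReductionAt
      (hC1 t ht v h1)
  rw [if_neg h1]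
  by_cases h2 : natGenerator v ∣ 27 * t - 1
  · rw [if_pos h2]
    obtain ⟨hm, hs⟩ := hC2 t ht v h2
    by_cases h3 : natGenerator v % 3 = 1
    · rw [if_pos h3]
      exact
        Literature.NumberTheory.EllipticCurves.localRootNumberAt_of_hasSplitMultiplicativeReductionAt
          (hs.mpr h3)
    · rw [if_neg h3]
      exact Literature.NumberTheory.EllipticCurves.localRootNumberAt_of_hasMultiplicativeReductionAt_of_not_split
        hm fun h => h3 (hs.mp h)
  · rw [if_neg h2]
    exact WeierstrassCurve.localRootNumberAt_of_hasGoodReductionAt (hesse_hasGoodReductionAt ht h1 h2)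

/-- `∏ᶠ_v w_v(E_t)` is the finite product of the local signs over the primes of `t(27t − 1)`
(the support of `v ↦ w_v(E_t)` lies over these primes, the place over `p` being
`primesEquiv.symm p`). -/
theorem hesse_finprod_localRootNumberAt
    (hC1 : ∀ t : ℕ, 1 ≤ t → ∀ v : HeightOneSpectrum ℤ, Rat.HeightOneSpectrum.natGenerator v ∣ t →
      ({ a₁ := 1, a₂ := 0, a₃ := (t : ℚ), a₄ := 0, a₆ := 0 } :
        WeierstrassCurve ℚ).HasSplitMultiplicativeReductionAt v)
    (hC2 : ∀ t : ℕ, 1 ≤ t → ∀ v : HeightOneSpectrum ℤ,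
      Rat.HeightOneSpectrum.natGenerator v ∣ 27 * t - 1 →
      ({ a₁ := 1, a₂ := 0, a₃ := (t : ℚ), a₄ := 0, a₆ := 0 } :
        WeierstrassCurve ℚ).HasMultiplicativeReductionAt v ∧
      (({ a₁ := 1, a₂ := 0, a₃ := (t : ℚ), a₄ := 0, a₆ := 0 } :
        WeierstrassCurve ℚ).HasSplitMultiplicativeReductionAt v ↔
        Rat.HeightOneSpectrum.natGenerator v % 3 = 1))
    {t : ℕ} (ht : 1 ≤ t) :
    ∏ᶠ v : HeightOneSpectrum ℤ,
        ({ a₁ := 1, a₂ := 0, a₃ := (t : ℚ), a₄ := 0, a₆ := 0 } :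
          WeierstrassCurve ℚ).localRootNumberAt v =
      ∏ p ∈ (t * (27 * t - 1)).primeFactors,
        (if p ∣ t then (-1 : ℤ) else if p % 3 = 1 then -1 else 1) := by
  set S : Finset ℕ := (t * (27 * t - 1)).primeFactors with hS
  set φ : {p // p ∈ S} → HeightOneSpectrum ℤ :=
    fun p => (primesEquiv (R := ℤ)).symm ⟨p.1, Nat.prime_of_mem_primeFactors p.2⟩ with hφ
  have hφinj : Function.Injective φ := by
    intro p q h
    have h' := congrArg (fun v : HeightOneSpectrum ℤ => ((primesEquiv v : Nat.Primes) : ℕ)) h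
    simp only [hφ, Equiv.apply_symm_apply] at h'
    exact Subtype.ext h'
  have hgen : ∀ p : {p // p ∈ S}, natGenerator (φ p) = p.1 := fun p =>
    Literature.NumberTheory.EllipticCurves.Rat.natGenerator_primesEquiv_symm _
  have hsupp : (Function.mulSupport fun v : HeightOneSpectrum ℤ =>
      ({ a₁ := 1, a₂ := 0, a₃ := (t : ℚ), a₄ := 0, a₆ := 0 } :
        WeierstrassCurve ℚ).localRootNumberAt v) ⊆
      (S.attach.image φ : Finset (HeightOneSpectrum ℤ)) := by
    intro v hv
    rw [Function.mem_mulSupport, hesse_localRootNumberAt hC1 hC2 ht v] at hv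
    have hdvd : natGenerator v ∣ t * (27 * t - 1) := by
      by_contra h
      refine hv ?_
      rw [if_neg fun h1 => h (Dvd.dvd.mul_right h1 _),
        if_neg fun h2 => h (Dvd.dvd.mul_left h2 _)]
    have hmem : natGenerator v ∈ S :=
      Nat.mem_primeFactors.mpr ⟨prime_natGenerator v, hdvd, mul_ne_zero (by omega) (by omega)⟩
    rw [Finset.coe_image]
    refine ⟨⟨natGenerator v, hmem⟩, by simp, ?_⟩
    rw [hφ, Equiv.symm_apply_eq]
    rfl
  rw [finprod_eq_prod_of_mulSupport_subset _ hsupp, Finset.prod_image fun p _ q _ h => hφinj h]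
  conv_rhs => rw [← Finset.prod_attach]
  refine Finset.prod_congr rfl fun p _ => ?_
  rw [hesse_localRootNumberAt hC1 hC2 ht (φ p), hgen p]
  have hp := Nat.mem_primeFactors.mp p.2
  by_cases h1 : p.1 ∣ t
  · rw [if_pos h1, if_pos h1]
  · have h2 : p.1 ∣ 27 * t - 1 := (hp.1.dvd_mul.mp hp.2.1).resolve_left h1
    rw [if_neg h1, if_neg h1, if_pos h2]

end StubAssemble

/-- **Stub F · `stub_assemble`.** For the `X₁(3)` family `E_t : y² + x·y + t·y = x³` (`t ≥ 1`):
granted split multiplicative reduction at the places over `p ∣ t` (C1) and multiplicative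
reduction, split iff `p ≡ 1 (mod 3)`, at the places over `p ∣ 27t − 1` (C2), the curve `E_t` is
elliptic, has no additive place, and its algebraic root number is
`−∏_p w_p(E_t) = −(−1)^{ω(t)} · (−1)^{#{p ∣ 27t−1 prime : p ≡ 1 (mod 3)}}`. -/
theorem stub_assemble :
    (∀ t : ℕ, 1 ≤ t → ∀ v : HeightOneSpectrum ℤ, Rat.HeightOneSpectrum.natGenerator v ∣ t →
      ({ a₁ := 1, a₂ := 0, a₃ := (t : ℚ), a₄ := 0, a₆ := 0 } : WeierstrassCurve ℚ).HasSplitMultiplicativeReductionAt v) →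
    (∀ t : ℕ, 1 ≤ t → ∀ v : HeightOneSpectrum ℤ, Rat.HeightOneSpectrum.natGenerator v ∣ 27 * t - 1 →
      ({ a₁ := 1, a₂ := 0, a₃ := (t : ℚ), a₄ := 0, a₆ := 0 } : WeierstrassCurve ℚ).HasMultiplicativeReductionAt v ∧
      (({ a₁ := 1, a₂ := 0, a₃ := (t : ℚ), a₄ := 0, a₆ := 0 } : WeierstrassCurve ℚ).HasSplitMultiplicativeReductionAt v ↔
        Rat.HeightOneSpectrum.natGenerator v % 3 = 1)) →
    ∀ t : ℕ, 1 ≤ t →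
      ({ a₁ := 1, a₂ := 0, a₃ := (t : ℚ), a₄ := 0, a₆ := 0 } : WeierstrassCurve ℚ).IsElliptic ∧
      (∀ v : HeightOneSpectrum ℤ,
        ¬ ({ a₁ := 1, a₂ := 0, a₃ := (t : ℚ), a₄ := 0, a₆ := 0 } : WeierstrassCurve ℚ).HasAdditiveReductionAt v) ∧
      ({ a₁ := 1, a₂ := 0, a₃ := (t : ℚ), a₄ := 0, a₆ := 0 } : WeierstrassCurve ℚ).algebraicRootNumber =
        -((-1 : ℤ) ^ ArithmeticFunction.cardDistinctFactors t) *
          (-1) ^ ((27 * t - 1).primeFactors.filter fun p => p % 3 = 1).card := by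
  intro hC1 hC2 t ht
  refine ⟨StubAssemble.hesse_isElliptic ht, fun v => ?_, ?_⟩
  · by_cases h1 : natGenerator v ∣ t
    · exact (hC1 t ht v h1).hasMultiplicativeReductionAt.not_hasAdditiveReductionAt
    · by_cases h2 : natGenerator v ∣ 27 * t - 1
      · exact (hC2 t ht v h2).1.not_hasAdditiveReductionAt
      · exact (StubAssemble.hesse_hasGoodReductionAt ht h1 h2).not_hasAdditiveReductionAt
  · rw [Literature.NumberTheory.EllipticCurves.algebraicRootNumber_def,
      StubAssemble.hesse_finprod_localRootNumberAt hC1 hC2 ht,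
      StubAssemble.prod_primeFactors_sign ht, neg_mul]

end Summit.QuantumAdvantage.QuantumAdvantage.Theorems.LiouvilleNotPPoly

end
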